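import Literature.MathematicalPhysics.QuantumFieldTheory.Balaban1983to89.Node00.N24ItemsStage13SepCoP
import Literature.MathematicalPhysics.QuantumFieldTheory.Balaban1983to89.Node00.Record13CarriersXPinnedH

/-!
# NODE N24 · (B2) AND K1⁵'s θ-KEYED CONSEQUENT AT A WORLD BOUND BY THE **S-BINDING** OVER THE FOUR-PIN VIEW OF seat dag-n05-d's **H-PINNED** STAGE-13 PARAMETER
# `(θ.pinX3H λ₈ λ₁₂ λ₁₃).view₁₃CoPB10YZW M⋆ ops ζ λW` (v1.5 `CoP ∕ SepCoP`) — THE CURRENCY IN WHICH N05's SUPPLIER DELIVERS: the `b8` leaf of that world IS the REPAIRED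
# SURVIVING SLOT `B8LeafOfRecordSubBH θ₃ λ₈` (dag-n05-d `Record13CarriersXPinnedH` §2b, `Iff.rfl`; served by `Summits/…/BalabanUVNodesN05SubBHKnitUniv(T8Srv)` at
# `λ₈ := λ.cutSubB J (zdLan ∘ ι) c₁` modulo its displayed sockets), N09 ∕ N10 read Lemma 4 ∕ the [B13] leaf AT THE FRAME ∕ GROUP OF RECORD `λ₁₂ ∕ λ₁₃`, N08 THE PRINTED
# `PrintedUV3V N θ.L`, N06 ∕ N07 ∕ N12 at the chosen layers, N11 ∧ N13 θ-keyed — (B) by node00-def-T's S-bound headline `endStatementBPrinted_of_nodesP_interval_guarded` AT THE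
# S-BOUND WORLD ITSELF (the ₁₂ five-pin recipe of module 25 `N24KnitStage12Carriers` §2 at Stage 13 v1.5)

TRACK A (YM-PLAN §2d, node N24 of 28 = binder B2 `hB : B16.EndStatementBPrinted D.C`), seat `pub-ymgap-dag-n24-c` (R134 fan-out seat, strategy s2; gen 5).  A NEW importing module
(imports this seat's thin v1.5 layer `N24ItemsStage13SepCoP` — whence the CoP engines, dag-n10-d's `Record13CarriersCoP ∕ SepCoP`, dag-n11-e's `B16RLeafRecord13LiveCoP` — and
dag-n05-d's `Record13CarriersXPinnedH` p526413: `XPinned₁₃H`, `Stage13Params.pinX3H := θ.rebindX (XPinned₁₃H …)`, `Provisos₁₃Core∕SepCoP.pinX3H`, `datumOfRecord₁₃CoP∕SepCoP_pinX3H`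
(`rfl`), the sockets `socket05S_toStage5₁₃CoP_pinX3H_iff` ∕ `socket09_pinX3H_iff` ∕ `socket10_pinX3H_iff` (`Iff.rfl`)).  THEOREMS ONLY, def-free, sorry-free, standard axioms.

WHY THIS VIEW (dag-n05-d LANDED-9∕10 + INTENT-12, INBOX l.19259; node00-def `CarriersB8.upOfRecord₅CS`): the C-binding's `b8` over any [B8]-pinned view is the leaf AS TYPED
(`B8LeafR …`, Theorem 8 as printed — kernel-refuted on print's admitted flat members for the un-repaired pin, unsupplied for the repaired one), so a K1 closer holding N05's
ACTUAL product — the knits' SURVIVING leaf over the repaired sub-family — must present the world by the S-BINDING `upOfRecord₅CS` (= the C-binding with `b8` alone re-bound,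
`upOfRecord₅CS_eq_withB8`, every other leaf `rfl`-equal).  This module's four-pin engine `N24NodesStage13FourPinPointedCoP` §1∕§6 binds by `upOfRecord₅C`; below is its S-bound
twin at the H-pin: SAME proof skeleton, `b8 := h05 : B8LeafOfRecordSubBH θ₃ λ₈` (`Iff.rfl` at the view), N01–N04 ∕ the guarded (0.20) ∕ the β-window carried from the C-BOUND TWIN
WORLD `{ w with up := upOfRecord₅C (…) }` (a ₁₃CCoP record at the same datum — `N24_isRecordOfRecord₁₃CCoP_of_up_view₁₃CoPB10YZW` at `θ.pinX3H …` + `datumOfRecord₁₃CoP_pinX3H`;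
the four sentences and the two leaves read no `b8`, transport `rfl`), N10 at the twin (`Dag.B13_main` reads `b9 b10 b11 b12 b13` only), N13's 𝐑-leaf reading through `withB8`
(`rfl`) and `rOpLeaf_VOfRecord₁₃CoP_iff` at the pin (laws at `θ.pinX3H …` ARE `θ`'s: `SLaw₁₃CoP_TLaw₁₃CoP_rebindX`, `rfl`).

HONEST LOCATED POINT (for plan g69 ∕ the K1⁵ closer; not a defect of any file): on N05's SURVIVING route the REGISTERED rung-1 body `NodesAtSomeRecord13P` (a C-bound
`IsRecordOfRecord₁₃CSepCoP … w'` ∧ `∀ P, Nodes (leavesP w' P)`) is NOT reachable — at the C-bound companion `Dag.B8_main` concludes the TYPED `b8` (`Dag.B8_main ℓ := … → ℓ.b8`),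
which the surviving leaf does not give (dag-n05-d: «typed ⇒ surviving, never conversely»); K1⁵'s TEXT (stmt-QuantumFields-20294: guard ∧ admissible ∧ (B) ∧ window at SOME
`(θ', h')`) IS reachable, by §2's θ-shape below, whose (B) comes from the S-bound headline at the S-bound world (no record predicate reads the binding).

WHAT THIS FILE PROVES (10 theorems).
§0 `N24_upS_pinX3H_view_b8_iff` (at dag-n05-d's H-pin the S-binding's `b8` over the four-pin view IS `B8LeafOfRecordSubBH θ₃ λ₈`; `Iff.rfl` at 400 k heartbeats — dag-n10-d's
   `Record13Carriers` §3 device), `N24_rOperation_iff_of_upS_rebindX_view` (the 𝐑-leaf reading at an S-bound four-pin view of `θ.rebindX X'`), `N24_isRecordOfRecord₁₃CCoP_twin_of_upS_rebindX_view`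
   (the C-bound twin world is a ₁₃CCoP record at the same datum; Core-keyed).
§1 **`N24_nodes₁₃CoP_rebindXS_fourPin_pointed`** (Core-keyed, carrier family `X'` FREE — the S-twin of `N24_nodes₁₃CoP_rebindX_fourPin_pointed`): the thirteen nodes at a world S-bound to
   the four-pin view of `θ.rebindX X'`, **N05 ← the S-binding's SURVIVING `b8` leaf `h05S`** (displayed at the view), every other child as in the C-bound engine (N06 `B9LeafX (Y9OfRecord …)`,
   N07 `B11Leaf (Z11OfRecord ζ)`, N08 `PrintedUV3V N θ.L`, N09 Lemma 4 at `X' P` + Thm-3 member, N10 the B13 socket at `X' P`, N11 (S1ᵀ), N12 `B15Leaf (WOfRecord₁₃ θ λW P)`, N13 (R₁₃) + (UV₁₃)).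
§2 **`N24_endStatementBPrinted₁₃CoP_rebindXS_fourPin_pointed`** ((B) at `(datumOfRecord₁₃CoP θ hP).C`, Core-keyed) and the ITEM-FACING **`N24_stabilityBR13SepCoP_thetaShape20_rebindXS_fourPin_pointed`**
   (K1⁵ 20294's θ-keyed consequent witnessed by `(θ, hP : θ.Provisos₁₃SepCoP)`, guard displayed).
§3 AT dag-n05-d's H-PIN `X' := XPinned₁₃H θ λ₈ λ₁₂ λ₁₃` (the three `Iff.rfl` sockets of `Record13CarriersXPinnedH` consumed): **`N24_nodes₁₃CoP_pinX3HS_fourPin_pointed`**,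
   **`N24_endStatementBPrinted₁₃CoP_pinX3HS_fourPin_pointed`**, **`N24_stabilityBR13SepCoP_thetaShape20_pinX3HS_fourPin_pointed`** — **N05 ← `B8LeafOfRecordSubBH θ.toStage3Params λ₈`**, **N09 ←
   `Lemma4Printed (F12OfRecord₁₂ θ₁₂ λ₁₂ P) (λ₁₂ P).consts`**, **N10 ← `B13LeafOfRecord θ₃ (λ₁₃ P)`** — and **`…_pinX3HS_fourPin_pointed_liveRepin₁₃`** (at node00-def-K0a's live re-pin:
   N13's (R₁₃), `Admissible`, `SlotsNondegenerate₁₃` discharged by name as in `N24ItemsStage13SepCoP` §2; `hZ` displayed).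
§4 (v1.1, APPEND-ONLY — plan g69's K1⁵ skeleton v3.1 `K1Skeleton13SepCoPv31`, REGISTERED on stmt-QuantumFields-20294 with the S-BOUND world class `RecordS`, INBOX l.19487):
   `N24_recordS₁₃SepCoP_of_upS_rebindX_view` (a world S-bound to the four-pin view of `θ.rebindX X'` IS in `RecordS F θ hP w` — ∃-body literal, presenting parameter the quadruply pinned
   re-bound θ), the REGISTERED RUNG BODIES at general `N` over that view — **`N24_nodesAtSomeRecordS₁₃SepCoP_of_rebindXS_fourPin_pointed`** (rung 1 `NodesAtSomeRecord13PWS`: S-class ∧ nodes ∧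
   `PrintedUV3V N θ.L` ∧ the [IV] basic-step reading at `λW` under the displayed selector bound `hK`) and **`N24_betaWindowAtSomeRecordS₁₃SepCoP_of_rebindXS_fourPin_pointed_of_boxH`** (rung 2
   `BetaWindowAtSomeRecord13S`) — and both AT dag-n05-d's H-PIN (`…_of_pinX3HS_fourPin_pointed`, `…_of_pinX3HS_fourPin_pointed_of_boxH`: N05 ← `B8LeafOfRecordSubBH θ₃ λ₈`).  15 theorems in all.

WHICH CHILD BLOCKS K1⁵ ON N05's SURVIVING ROUTE (kernel = §2's hypothesis list): K0⁵'s `hP` + guard · world S-bound to the five-pin-H view (free: any letters, `w.up := upOfRecord₅CS …`)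
· **N05 `B8LeafOfRecordSubBH θ.toStage3Params λ₈`** (dag-n05-d's served knit at `λ₈ := λ.cutSubB J (zdLan ∘ ι) c₁`, modulo its displayed Prop-5∕6∕7 + [4]-type sockets) · N06 ∕ N07 ∕ N12
leaves at chosen layers · N08 PRINTED · N09 Lemma 4 at `F12OfRecord₁₂ θ₁₂ λ₁₂` + Thm-3 member · N10 `B13LeafOfRecord θ₃ (λ₁₃ P)` · N11 (S1ᵀ) · N13 (R₁₃) (a theorem on the live line) +
(UV₁₃) · β-box pair ([I] (1.22); lower half UNPRINTED, node O).
HONEST FRAMING: kernel bookkeeping BY NAME; nothing of Bałaban's asserted; every slot DISPLAYED; N24 COMPOSITE — no discharge, no count moved (5∕27), no stub closed; one finite T⁴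
programme at fixed ε; NOT continuum ∕ ℝ⁴ ∕ OS ∕ mass gap ∕ Clay.
-/

noncomputable section

open scoped Matrix.Norms.L2Operator

namespace Literature.MathematicalPhysics.QuantumFieldTheory.Balaban1983to89.Node00

open DagBinding T4Continuum T4DatumAssembly FlowStepRuns AveragingRT
open FlowStep (BetaLowerH BetaUpperH)
open B14NodeKnitRecord9 (b14_main_at_construction_rhoOfRecord9_along)
open B16NodeKnitRepTowerOfRecord (b16_main_at_repTowerOfRecord_along)
open B16RLeafRecord13LiveCoP (laws₁₃CoP_of_liveSel_of_rstep)

variable {F : T4Family} {N : ℕ} [NeZero N]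

/-! ## §0. The S-binding over the four-pin view of a re-bound parameter: `b8` at dag-n05-d's H-pin is the repaired surviving slot; the 𝐑-leaf reading; the C-bound twin record -/

set_option maxHeartbeats 400000 in
/-- **AT dag-n05-d's H-PIN, THE `b8` LEAF OF THE S-BINDING OVER THE FOUR-PIN VIEW IS THE REPAIRED SURVIVING SLOT `B8LeafOfRecordSubBH θ₃ λ₈`** (`Iff.rfl`: the [B10] ∕ Y ∕ Z ∕ W
pins leave the [B8] fields of `XPinned₁₃H` untouched — dag-n05-d's `socket05S_toStage5₁₃CoP_pinX3H_iff` under dag-n10-d's four-pin chain; the comparison unfolds the C-binding's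
thirteen-field literal under five structure updates, whence the raised heartbeat budget — the same device as dag-n10-d's `Record13Carriers` §3).
[cite: Balaban1985RegularSpaces, Lemma 1 – Thm 8 pp.79–101, Thm 8 (1.146) p.101 (the surviving leaf at the repaired objects of record; bookkeeping)] -/
theorem N24_upS_pinX3H_view_b8_iff (θ : Stage13Params F N) (lam8 : ResidB8 θ.toStage3Params) (lam12 : ResidB12 F N θ.τ9.M)
    (lam13 : B12.RunParams → ResidB13 θ.toStage3Params) (Mstar : ℕ) (ops : OpsY N θ.toStage3Params Mstar) (ζ : ResidZ F N) (lamW : ResidW F N) (P : B12.RunParams) :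
    (upOfRecord₅CS F N ((θ.pinX3H F N lam8 lam12 lam13).view₁₃CoPB10YZW F N Mstar ops ζ lamW) P).b8 ↔ B8LeafOfRecordSubBH θ.toStage3Params lam8 :=
  Iff.rfl

/-- **The pins and the S-binding never touch the 𝐑-carrier**: at a world S-bound to the four-pin view of `θ.rebindX X'`,
`(leavesP w P).rOperation ↔ ∀ k < K, TLaw₁₃CoP θ P k → SLaw₁₃CoP θ P (k+1)` (`withB8` keeps `rOperation`; `Iff.rfl` to `ROpLeaf (VOfRecord₁₃CoP (θ.rebindX X') P)`, node00-def-T's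
`rOpLeaf_VOfRecord₁₃CoP_iff`, and the laws at the re-bound parameter ARE `θ`'s — dag-n10-d's `SLaw₁₃CoP_TLaw₁₃CoP_rebindX`, `rfl`). [cite: Balaban1989LargeFieldII, Thm 1 p.355; Balaban1988Convergent, p.244 and Thm 2 p.263 (bookkeeping: the leaf unfolded)] -/
theorem N24_rOperation_iff_of_upS_rebindX_view (θ : Stage13Params F N) (X' : B12.RunParams → PrintedCarriersR) (Mstar : ℕ) (ops : OpsY N θ.toStage3Params Mstar)
    (ζ : ResidZ F N) (lamW : ResidW F N) {w : WorldP} {P : B12.RunParams}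
    (hup : w.up P = upOfRecord₅CS F N ((θ.rebindX F N X').view₁₃CoPB10YZW F N Mstar ops ζ lamW) P) :
    (leavesP w P).rOperation ↔ ∀ k, k < P.K → TLaw₁₃CoP F N θ P k → SLaw₁₃CoP F N θ P (k + 1) := by
  have hV : (leavesP w P).rOperation ↔ ROpLeaf (VOfRecord₁₃CoP F N (θ.rebindX F N X') P) := by
    show (w.up P).rOperation ↔ _
    rw [hup]
    exact Iff.rfl
  exact hV.trans (rOpLeaf_VOfRecord₁₃CoP_iff F N (θ.rebindX F N X') P)

/-- **THE C-BOUND TWIN WORLD IS A v1.5 CORE RECORD AT THE SAME DATUM**: `{ w with up := upOfRecord₅C (the four-pin view of θ.rebindX X') }` — same `C`, letters, window, block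
size (this seat's `N24_isRecordOfRecord₁₃CCoP_of_up_view₁₃CoPB10YZW` at `θ.rebindX X'`, datum read back by dag-n10-d's `datumOfRecord₁₃CoP_rebindX`).  N01–N04, the guarded (0.20)
and the β-window transfer from it (none reads `b8`). [cite: Balaban1989LargeFieldII, Thm 1 + (0.1) pp.355–356 (bookkeeping)] -/
theorem N24_isRecordOfRecord₁₃CCoP_twin_of_upS_rebindX_view (θ : Stage13Params F N) (hP : θ.Provisos₁₃Core F N) (hθ : θ.Admissible F N)
    (X' : B12.RunParams → PrintedCarriersR) (Mstar : ℕ) (ops : OpsY N θ.toStage3Params Mstar) (ζ : ResidZ F N) (lamW : ResidW F N) (w : WorldP)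
    (hC : w.C = (datumOfRecord₁₃CoP F N θ hP).C) (hγ : 0 < w.γ ∧ w.γ ≤ θ.γ) (hL : w.L = (θ.L : ℝ)) :
    IsRecordOfRecord₁₃CCoP F N (datumOfRecord₁₃CoP F N θ hP)
      { w with up := fun P => upOfRecord₅C F N ((θ.rebindX F N X').view₁₃CoPB10YZW F N Mstar ops ζ lamW) P } := by
  have hX : (θ.rebindX F N X').Provisos₁₃Core F N := hP.rebindX X'
  have hD : datumOfRecord₁₃CoP F N (θ.rebindX F N X') hX = datumOfRecord₁₃CoP F N θ hP := datumOfRecord₁₃CoP_rebindX F N θ hP X' hX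
  rw [← hD]
  exact N24_isRecordOfRecord₁₃CCoP_of_up_view₁₃CoPB10YZW (θ.rebindX F N X') hX ((Stage13Params.rebindX_admissible_iff F N θ X').2 hθ)
    Mstar ops ζ lamW _ (hC.trans (congrArg FiniteEpsData.C hD.symm)) hγ hL (fun _ => rfl)

/-! ## §1. The thirteen nodes at a world S-bound to the four-pin view of `θ.rebindX X'` — N05 ← the S-binding's SURVIVING leaf -/

/-- **N24 · THE THIRTEEN DAG NODES AT A WORLD S-BOUND TO THE FOUR-PIN VIEW OF `θ.rebindX X'`** (Core-keyed; the S-twin of `N24_nodes₁₃CoP_rebindX_fourPin_pointed`): **N05 ← the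
SURVIVING `b8` leaf of that S-binding** (`h05S`, displayed at the view; at dag-n05-d's H-pin it IS `B8LeafOfRecordSubBH θ₃ λ₈`, §0 ∕ §3); N06 `B9LeafX (Y9OfRecord …)`;
N07 `B11Leaf (Z11OfRecord F N ζ)`; **N08 `PrintedUV3V N θ.L`**; N09 own leaf at `X' P` + Theorem-3 member `h09T`; N10 B13 socket at `X' P`; N11 (S1ᵀ) `h11` (its `b8` antecedent is
the surviving leaf here); N12 `B15Leaf (WOfRecord₁₃ θ λW P)`; N13 (R₁₃) `hR` + (UV₁₃) `hUV`; N01 ∕ N02 ∕ N04 node00-def-T's transferred theorems and N03 at the C-bound twin, N10 at the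
twin (`B13NodeKnitRecord5C.b13_main_at_stage5ParamsC`; `Dag.B13_main` reads `b9 b10 b11 b12 b13` only) — transported by `rfl` (`upOfRecord₅CS_eq_withB8`, `leavesP_eq_of_up_withB8`).
[cite: Balaban1989LargeFieldII, Thm 1 p.355, (0.1) pp.355–356, p.387, p.391; Balaban1985RegularSpaces, Lemma 1 – Thm 8 pp.79–101, Thm 8 (1.146) p.101 (surviving form); Balaban1985UV3, Thm 1 p.257 + Thm 2 p.272; Balaban1985BackgroundPropagators, Thm 3.1 p.397; Balaban1985Variational, Thm 1 p.279 + Thm 3 p.278; Balaban1988Convergent, Thm 1 p.262, Theorem p.245, p.244, (2.18) p.257, Cor. 3 (2.50) p.264; Balaban1987RG1, Thm 1 p.259, Thm 3 p.264, Lemma 4 p.280; Balaban1988RG2Cluster, Lemmas 1–3 pp.9–20; Balaban1989LargeFieldI, Prop. 1 p.194, (0.2)–(0.4) p.176 (bookkeeping)] -/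
theorem N24_nodes₁₃CoP_rebindXS_fourPin_pointed (θ : Stage13Params F N) (hP : θ.Provisos₁₃Core F N) (hθ : θ.Admissible F N)
    (X' : B12.RunParams → PrintedCarriersR) (Mstar : ℕ) (ops : OpsY N θ.toStage3Params Mstar) (ζ : ResidZ F N) (lamW : ResidW F N) (w : WorldP)
    (hC : w.C = (datumOfRecord₁₃CoP F N θ hP).C) (hγ : 0 < w.γ ∧ w.γ ≤ θ.γ) (hL : w.L = (θ.L : ℝ))
    (hup : ∀ P, w.up P = upOfRecord₅CS F N ((θ.rebindX F N X').view₁₃CoPB10YZW F N Mstar ops ζ lamW) P)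
    (h05S : ∀ P : B12.RunParams, (upOfRecord₅CS F N ((θ.rebindX F N X').view₁₃CoPB10YZW F N Mstar ops ζ lamW) P).b8)
    (h06 : B9LeafX (Y9OfRecord N θ.toStage3Params Mstar ops))
    (h07 : B11Leaf (Z11OfRecord F N ζ))
    (h08 : PrintedUV3V N θ.L)
    (h09 : ∀ P : B12.RunParams, B12Sec2to5.Lemma4Printed (X' P).F12 (X' P).c12)
    (h09T : ∀ P : B12.RunParams, (leavesP w P).smallCouplings → (leavesP w P).smallFieldInductive)
    (h10 : ∀ P : B12.RunParams, B9LeafX (Y9OfRecord N θ.toStage3Params Mstar ops) →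
      (B10.Thm1PrintedCompact (((θ.rebindX F N X').view₁₃CoPB10YZW F N Mstar ops ζ lamW).res.X P).runs10 ∧
          B10.Thm2Printed (((θ.rebindX F N X').view₁₃CoPB10YZW F N Mstar ops ζ lamW).res.X P).runs10) →
        B11Leaf (Z11OfRecord F N ζ) → B12Sec2to5.Lemma4Printed (X' P).F12 (X' P).c12 →
          B13.Lemma1Printed (X' P).S13 (X' P).c13 ∧ B13.Lemma2Printed (X' P).S13 (X' P).c13 ∧
            B13.Lemma3Printed (X' P).S13 (X' P).c13)
    (h11 : ∀ P : B12.RunParams, (leavesP w P).b7 → (leavesP w P).b8 → (leavesP w P).b9 → (leavesP w P).b10 → (leavesP w P).b11 →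
      (leavesP w P).smallCouplings → (leavesP w P).smallFieldInductive → (leavesP w P).flowControl →
        ∀ k, k < P.K → SLaw₁₃CoP F N θ P k → TLaw₁₃CoP F N θ P k)
    (h12 : ∀ P : B12.RunParams, B15Leaf (WOfRecord₁₃ F N θ lamW P))
    (hR : ∀ (P : B12.RunParams) (k : ℕ), k < P.K → TLaw₁₃CoP F N θ P k → SLaw₁₃CoP F N θ P (k + 1))
    (hUV : ∀ P : B12.RunParams, (genFlow (betaOfRecord₁₃ F N θ) P.g0).InInterval w.γ P.K → ∀ k, k ≤ P.K → SLaw₁₃CoP F N θ P k →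
      ∀ U : GaugeField (F.P P.K) k (SU N),
        chiβOfRecord₁₃ F N θ P.K (gOfRecord₁₃ F N θ P) k U *
              Real.exp (-(1 / (gOfRecord₁₃ F N θ P k) ^ 2 * wilsonBGOfRecord F N θ.εbg P k U)
                - w.em (gOfRecord₁₃ F N θ P k) * (Fintype.card (Site (F.P P.K) k) : ℝ)) ≤ densOfRecord₁₃ F N θ P k U ∧
        densOfRecord₁₃ F N θ P k U ≤ Real.exp (w.ep (gOfRecord₁₃ F N θ P k) * (Fintype.card (Site (F.P P.K) k) : ℝ))) :
    ∀ P : B12.RunParams, Nodes (leavesP w P) := by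
  intro P
  have hrec' := N24_isRecordOfRecord₁₃CCoP_twin_of_upS_rebindX_view θ hP hθ X' Mstar ops ζ lamW w hC hγ hL
  have hw8 : ∀ P, w.up P = (upOfRecord₅C F N ((θ.rebindX F N X').view₁₃CoPB10YZW F N Mstar ops ζ lamW) P).withB8 (leavesP w P).b8 := fun P => by
    show w.up P = (upOfRecord₅C F N _ P).withB8 (w.up P).b8
    rw [hup P]
    exact upOfRecord₅CS_eq_withB8 F N _ P
  have hleaves := leavesP_eq_of_up_withB8 hw8 P
  have h4 : Dag.B4_main (leavesP w P) := by rw [hleaves]; exact b4_main_of_isRecordOfRecord₁₃CCoP hrec' P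
  have h5 : Dag.B5_main (leavesP w P) := by rw [hleaves]; exact b5_main_of_isRecordOfRecord₁₃CCoP hrec' P
  have h6 : Dag.B6_main (leavesP w P) := by rw [hleaves]; exact N24_b6_main_of_isRecordOfRecord₁₃CCoP hrec' P
  have h7 : Dag.B7_main (leavesP w P) := by rw [hleaves]; exact b7_main_of_isRecordOfRecord₁₃CCoP hrec' P
  have hl := upOfRecord₅C_view₁₃CoPB10YZW_leaves F N (θ.rebindX F N X') Mstar ops ζ lamW P
  have h8 : (w.up P).b8 := by
    rw [hup P]; exact h05S P
  have h9 : (w.up P).b9 := by rw [hup P]; exact hl.2.1.2 h06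
  have h10leaf : (w.up P).b10 := by rw [hup P]; exact hl.2.2.1.2 h08
  have h11leaf : (w.up P).b11 := by rw [hup P]; exact hl.2.2.2.2 h07
  have h15 : (w.up P).rBasicStep := by rw [hup P]; exact hl.1.2 (h12 P)
  have h12leaf : (leavesP w P).b12 := by
    show (w.up P).b12
    rw [hup P]; exact h09 P
  have h13 : Dag.B13_main (leavesP w P) := by
    have h' : Dag.B13_main (leavesP { w with up := fun P => upOfRecord₅C F N ((θ.rebindX F N X').view₁₃CoPB10YZW F N Mstar ops ζ lamW) P } P) :=
      B13NodeKnitRecord5C.b13_main_at_stage5ParamsC F N ((θ.rebindX F N X').view₁₃CoPB10YZW F N Mstar ops ζ lamW) _ P rfl (h10 P)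
    show (w.up P).b9 → (w.up P).b10 → (w.up P).b11 → (w.up P).b12 → (w.up P).b13
    rw [hup P]
    exact h'
  have hrop := N24_rOperation_iff_of_upS_rebindX_view θ X' Mstar ops ζ lamW (hup P)
  exact ⟨h4, h5, h6, h7, B8LeafKnit.b8_main_of_leaf w P h8, fun _ _ _ _ => h9, fun _ _ _ _ _ _ => h10leaf,
    fun _ _ _ _ _ => h11leaf, B12NodeKnitRecord8.b12_main_of_leaf_of_thm3Member h12leaf (h09T P), h13,
    b14_main_at_construction_rhoOfRecord9_along F N (coreOfRecord₁₃CoP F N θ) w P θ.ν θ.τ9 (EOfRecord₁₃ F N θ) (wOfRecord₉ F N θ.toStage9Params) θ.ppSel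
      (gOfRecord₁₃ F N θ) (fun p k _ => SLaw₁₃CoP F N θ p k) (fun p k _ => TLaw₁₃CoP F N θ p k) (hC.trans (datumOfRecord₁₃CoP_C F N θ hP))
      (fun _ _ => Iff.rfl) (fun _ => sLaw₁₃CoP_zero F N θ P) (h11 P) (fun hr => hrop.1 hr),
    B15LeafKnit.b15_main_of_up (U := w.up P) rfl h15,
    b16_main_at_repTowerOfRecord_along F N (coreOfRecord₁₃CoP F N θ) w P θ.ν θ.τ9 (EOfRecord₁₃ F N θ) (wOfRecord₉ F N θ.toStage9Params) θ.ppSel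
      (gOfRecord₁₃ F N θ) (fun k _ => SLaw₁₃CoP F N θ P k) (fun k _ => TLaw₁₃CoP F N θ P k) (hC.trans (datumOfRecord₁₃CoP_C F N θ hP))
      (fun _ _ => Iff.rfl) hrop.2 (hR P) le_rfl (hUV P)⟩

/-! ## §2. (B) at the datum and item K1⁵'s θ-keyed consequent, at a world S-bound to the four-pin view of `θ.rebindX X'` -/

/-- **N24 · (B2) AT `(datumOfRecord₁₃CoP θ hP).C` FROM THE POINTED CHILDREN, N05 IN ITS SURVIVING FORM, AND THE β-BOX PAIR** (Core-keyed): node00-def-T's S-bound headline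
`endStatementBPrinted_of_nodesP_interval_guarded` AT THE S-BOUND WORLD (no record predicate reads the binding) — nodes by §1, the guarded (0.20) and the β-window from the
C-bound twin record (`rgFlow_of_smallCouplings_of_isRecordOfRecord₁₃CCoP`, `N24_betaBoundsInInterval_of_isRecordOfRecord₁₃CCoP_of_boxH`; both read `w.C`, `w.γ` only).
[cite: Balaban1989LargeFieldII, Thm 1 p.355 + p.391; Balaban1987RG1, (0.20) p.256, (1.22) p.264; Balaban1985RegularSpaces, Thm 8 (1.146) p.101 (bookkeeping + elementary window)] -/
theorem N24_endStatementBPrinted₁₃CoP_rebindXS_fourPin_pointed (θ : Stage13Params F N) (hP : θ.Provisos₁₃Core F N) (hθ : θ.Admissible F N)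
    (X' : B12.RunParams → PrintedCarriersR) (Mstar : ℕ) (ops : OpsY N θ.toStage3Params Mstar) (ζ : ResidZ F N) (lamW : ResidW F N) (w : WorldP)
    (hC : w.C = (datumOfRecord₁₃CoP F N θ hP).C) (hγ : 0 < w.γ ∧ w.γ ≤ θ.γ) (hL : w.L = (θ.L : ℝ))
    (hup : ∀ P, w.up P = upOfRecord₅CS F N ((θ.rebindX F N X').view₁₃CoPB10YZW F N Mstar ops ζ lamW) P)
    (h05S : ∀ P : B12.RunParams, (upOfRecord₅CS F N ((θ.rebindX F N X').view₁₃CoPB10YZW F N Mstar ops ζ lamW) P).b8)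
    (h06 : B9LeafX (Y9OfRecord N θ.toStage3Params Mstar ops))
    (h07 : B11Leaf (Z11OfRecord F N ζ))
    (h08 : PrintedUV3V N θ.L)
    (h09 : ∀ P : B12.RunParams, B12Sec2to5.Lemma4Printed (X' P).F12 (X' P).c12)
    (h09T : ∀ P : B12.RunParams, (leavesP w P).smallCouplings → (leavesP w P).smallFieldInductive)
    (h10 : ∀ P : B12.RunParams, B9LeafX (Y9OfRecord N θ.toStage3Params Mstar ops) →
      (B10.Thm1PrintedCompact (((θ.rebindX F N X').view₁₃CoPB10YZW F N Mstar ops ζ lamW).res.X P).runs10 ∧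
          B10.Thm2Printed (((θ.rebindX F N X').view₁₃CoPB10YZW F N Mstar ops ζ lamW).res.X P).runs10) →
        B11Leaf (Z11OfRecord F N ζ) → B12Sec2to5.Lemma4Printed (X' P).F12 (X' P).c12 →
          B13.Lemma1Printed (X' P).S13 (X' P).c13 ∧ B13.Lemma2Printed (X' P).S13 (X' P).c13 ∧
            B13.Lemma3Printed (X' P).S13 (X' P).c13)
    (h11 : ∀ P : B12.RunParams, (leavesP w P).b7 → (leavesP w P).b8 → (leavesP w P).b9 → (leavesP w P).b10 → (leavesP w P).b11 →
      (leavesP w P).smallCouplings → (leavesP w P).smallFieldInductive → (leavesP w P).flowControl →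
        ∀ k, k < P.K → SLaw₁₃CoP F N θ P k → TLaw₁₃CoP F N θ P k)
    (h12 : ∀ P : B12.RunParams, B15Leaf (WOfRecord₁₃ F N θ lamW P))
    (hR : ∀ (P : B12.RunParams) (k : ℕ), k < P.K → TLaw₁₃CoP F N θ P k → SLaw₁₃CoP F N θ P (k + 1))
    (hUV : ∀ P : B12.RunParams, (genFlow (betaOfRecord₁₃ F N θ) P.g0).InInterval w.γ P.K → ∀ k, k ≤ P.K → SLaw₁₃CoP F N θ P k →
      ∀ U : GaugeField (F.P P.K) k (SU N),
        chiβOfRecord₁₃ F N θ P.K (gOfRecord₁₃ F N θ P) k U *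
              Real.exp (-(1 / (gOfRecord₁₃ F N θ P k) ^ 2 * wilsonBGOfRecord F N θ.εbg P k U)
                - w.em (gOfRecord₁₃ F N θ P k) * (Fintype.card (Site (F.P P.K) k) : ℝ)) ≤ densOfRecord₁₃ F N θ P k U ∧
        densOfRecord₁₃ F N θ P k U ≤ Real.exp (w.ep (gOfRecord₁₃ F N θ P k) * (Fintype.card (Site (F.P P.K) k) : ℝ))) 
    (hlo : BetaLowerH w.b w.γ (datumOfRecord₁₃CoP F N θ hP).βfun) (hhi : BetaUpperH w.βup w.γ (datumOfRecord₁₃CoP F N θ hP).βfun) :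
    B16.EndStatementBPrinted (datumOfRecord₁₃CoP F N θ hP).C := by
  have hrec' := N24_isRecordOfRecord₁₃CCoP_twin_of_upS_rebindX_view θ hP hθ X' Mstar ops ζ lamW w hC hγ hL
  have hn := N24_nodes₁₃CoP_rebindXS_fourPin_pointed θ hP hθ X' Mstar ops ζ lamW w hC hγ hL hup h05S h06 h07 h08 h09 h09T h10 h11 h12 hR hUV
  rw [← hC]
  exact endStatementBPrinted_of_nodesP_interval_guarded w hγ.1 le_rfl hn (fun P hsc => rgFlow_of_smallCouplings_of_isRecordOfRecord₁₃CCoP hrec' P hsc)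
    (N24_betaBoundsInInterval_of_isRecordOfRecord₁₃CCoP_of_boxH hrec' hlo hhi)

/-- **★ ITEM K1⁵ (stmt-QuantumFields-20294)'s θ-KEYED CONSEQUENT, WITNESSED BY `(θ, hP)`, FROM THE POINTED CHILDREN WITH N05 IN ITS SURVIVING FORM** — the world S-bound to the
four-pin view of `θ.rebindX X'`, guard `hU` displayed; (B) by the previous theorem at `hP.toCore` (datum bridge `rfl`), window by module 26.  COMPOSITE: nothing is discharged.
[cite: Balaban1989LargeFieldII, Thm 1 p.355, (0.1) pp.355–356, p.391; Balaban1985RegularSpaces, Thm 8 (1.146) p.101; Balaban1987RG1, Thm 3 p.264, (0.17)–(0.20) pp.255–256 and (1.22) p.264; Balaban1985UV3, Thm 1 p.257 (bookkeeping + elementary window)] -/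
theorem N24_stabilityBR13SepCoP_thetaShape20_rebindXS_fourPin_pointed (θ : Stage13Params F N) (hP : θ.Provisos₁₃SepCoP F N) (hθ : θ.Admissible F N)
    (hU : θ.ZtUnity F N ∧ θ.SlotsNondegenerate₁₃ F N)
    (X' : B12.RunParams → PrintedCarriersR) (Mstar : ℕ) (ops : OpsY N θ.toStage3Params Mstar) (ζ : ResidZ F N) (lamW : ResidW F N) (w : WorldP)
    (hC : w.C = (datumOfRecord₁₃SepCoP F N θ hP).C) (hγ : 0 < w.γ ∧ w.γ ≤ θ.γ) (hL : w.L = (θ.L : ℝ))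
    (hup : ∀ P, w.up P = upOfRecord₅CS F N ((θ.rebindX F N X').view₁₃CoPB10YZW F N Mstar ops ζ lamW) P)
    (h05S : ∀ P : B12.RunParams, (upOfRecord₅CS F N ((θ.rebindX F N X').view₁₃CoPB10YZW F N Mstar ops ζ lamW) P).b8)
    (h06 : B9LeafX (Y9OfRecord N θ.toStage3Params Mstar ops))
    (h07 : B11Leaf (Z11OfRecord F N ζ))
    (h08 : PrintedUV3V N θ.L)
    (h09 : ∀ P : B12.RunParams, B12Sec2to5.Lemma4Printed (X' P).F12 (X' P).c12)
    (h09T : ∀ P : B12.RunParams, (leavesP w P).smallCouplings → (leavesP w P).smallFieldInductive)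
    (h10 : ∀ P : B12.RunParams, B9LeafX (Y9OfRecord N θ.toStage3Params Mstar ops) →
      (B10.Thm1PrintedCompact (((θ.rebindX F N X').view₁₃CoPB10YZW F N Mstar ops ζ lamW).res.X P).runs10 ∧
          B10.Thm2Printed (((θ.rebindX F N X').view₁₃CoPB10YZW F N Mstar ops ζ lamW).res.X P).runs10) →
        B11Leaf (Z11OfRecord F N ζ) → B12Sec2to5.Lemma4Printed (X' P).F12 (X' P).c12 →
          B13.Lemma1Printed (X' P).S13 (X' P).c13 ∧ B13.Lemma2Printed (X' P).S13 (X' P).c13 ∧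
            B13.Lemma3Printed (X' P).S13 (X' P).c13)
    (h11 : ∀ P : B12.RunParams, (leavesP w P).b7 → (leavesP w P).b8 → (leavesP w P).b9 → (leavesP w P).b10 → (leavesP w P).b11 →
      (leavesP w P).smallCouplings → (leavesP w P).smallFieldInductive → (leavesP w P).flowControl →
        ∀ k, k < P.K → SLaw₁₃CoP F N θ P k → TLaw₁₃CoP F N θ P k)
    (h12 : ∀ P : B12.RunParams, B15Leaf (WOfRecord₁₃ F N θ lamW P))
    (hR : ∀ (P : B12.RunParams) (k : ℕ), k < P.K → TLaw₁₃CoP F N θ P k → SLaw₁₃CoP F N θ P (k + 1))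
    (hUV : ∀ P : B12.RunParams, (genFlow (betaOfRecord₁₃ F N θ) P.g0).InInterval w.γ P.K → ∀ k, k ≤ P.K → SLaw₁₃CoP F N θ P k →
      ∀ U : GaugeField (F.P P.K) k (SU N),
        chiβOfRecord₁₃ F N θ P.K (gOfRecord₁₃ F N θ P) k U *
              Real.exp (-(1 / (gOfRecord₁₃ F N θ P k) ^ 2 * wilsonBGOfRecord F N θ.εbg P k U)
                - w.em (gOfRecord₁₃ F N θ P k) * (Fintype.card (Site (F.P P.K) k) : ℝ)) ≤ densOfRecord₁₃ F N θ P k U ∧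
        densOfRecord₁₃ F N θ P k U ≤ Real.exp (w.ep (gOfRecord₁₃ F N θ P k) * (Fintype.card (Site (F.P P.K) k) : ℝ))) 
    (hlo : BetaLowerH w.b w.γ (datumOfRecord₁₃SepCoP F N θ hP).βfun) (hhi : BetaUpperH w.βup w.γ (datumOfRecord₁₃SepCoP F N θ hP).βfun) :
    ∃ (θ' : Stage13Params F N) (h' : θ'.Provisos₁₃SepCoP F N), (θ'.ZtUnity F N ∧ θ'.SlotsNondegenerate₁₃ F N) ∧ θ'.Admissible F N ∧
      B16.EndStatementBPrinted (datumOfRecord₁₃SepCoP F N θ' h').C ∧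
      ∃ γ₁ : ℝ, 0 < γ₁ ∧ ∀ γ : ℝ, 0 < γ → γ ≤ γ₁ → ∃ P : B12.RunParams, 1 ≤ P.K ∧ ((datumOfRecord₁₃SepCoP F N θ' h').C P).flow.InInterval γ P.K :=
  ⟨θ, hP, hU, hθ, N24_endStatementBPrinted₁₃CoP_rebindXS_fourPin_pointed θ hP.toCore hθ X' Mstar ops ζ lamW w hC hγ hL hup h05S h06 h07 h08 h09 h09T h10 h11 h12 hR hUV hlo hhi,
    N24_window_of_betaUpperH _ hγ.1 hhi⟩

/-! ## §3. At dag-n05-d's H-PINNED parameter `X' := XPinned₁₃H θ λ₈ λ₁₂ λ₁₃`: N05 ← the REPAIRED SURVIVING SLOT `B8LeafOfRecordSubBH θ₃ λ₈`, N09 ← Lemma 4 at the [B12] frame of record, N10 ← the [B13] leaf of record (the three `Iff.rfl` sockets of `Record13CarriersXPinnedH`) -/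

/-- **N24 · THE THIRTEEN DAG NODES AT A WORLD S-BOUND TO THE FOUR-PIN VIEW OF `θ.pinX3H λ₈ λ₁₂ λ₁₃`** (Core-keyed): **N05 ← `B8LeafOfRecordSubBH θ₃ λ₈`** (the repaired surviving slot
dag-n05-d's knits serve); N06 `B9LeafX (Y9OfRecord N θ₃ M⋆ ops)`; N07 `B11Leaf (Z11OfRecord F N ζ)`; **N08 `PrintedUV3V N θ.L`**; **N09 Lemma 4 AT THE [B12] FRAME OF RECORD `λ₁₂`** +
its Theorem-3 member `h09T` DISPLAYED; **N10 the [B13] leaf `B13LeafOfRecord θ₃ (λ₁₃ P)`**; N11 (S1ᵀ) `h11` (its `b8` antecedent is the surviving leaf here); N12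
`B15Leaf (WOfRecord₁₃ θ λW P)`; N13 (R₁₃) `hR` + (UV₁₃) `hUV`; N01 ∕ N02 ∕ N04 def-T's transferred theorems and N03 `N24_b6_main_of_isRecordOfRecord₁₃CCoP` at the C-bound twin,
N10 at the twin (`B13NodeKnitRecord5C.b13_main_at_stage5ParamsC`), all transported by `rfl` (`withB8`).  THE HYPOTHESIS LIST IS «WHICH CHILD BLOCKS ON N05's SURVIVING ROUTE».
[cite: Balaban1989LargeFieldII, Thm 1 p.355, (0.1) pp.355–356, p.387, p.391; Balaban1985RegularSpaces, Lemma 1 – Thm 8 pp.79–101, Thm 8 (1.146) p.101 (surviving form); Balaban1985UV3, Thm 1 p.257 + Thm 2 p.272; Balaban1985BackgroundPropagators, Thm 3.1 p.397; Balaban1985Variational, Thm 1 p.279 + Thm 3 p.278; Balaban1988Convergent, Thm 1 p.262, Theorem p.245, p.244, (2.18) p.257, Cor. 3 (2.50) p.264; Balaban1987RG1, Thm 1 p.259, Thm 3 p.264, Lemma 4 p.280; Balaban1988RG2Cluster, Lemmas 1–3 pp.9–20; Balaban1989LargeFieldI, Prop. 1 p.194, (0.2)–(0.4) p.176 (bookkeeping)]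 -/
theorem N24_nodes₁₃CoP_pinX3HS_fourPin_pointed (θ : Stage13Params F N) (hP : θ.Provisos₁₃Core F N) (hθ : θ.Admissible F N)
    (lam8 : ResidB8 θ.toStage3Params) (lam12 : ResidB12 F N θ.τ9.M) (lam13 : B12.RunParams → ResidB13 θ.toStage3Params)
    (Mstar : ℕ) (ops : OpsY N θ.toStage3Params Mstar) (ζ : ResidZ F N) (lamW : ResidW F N) (w : WorldP)
    (hC : w.C = (datumOfRecord₁₃CoP F N θ hP).C) (hγ : 0 < w.γ ∧ w.γ ≤ θ.γ) (hL : w.L = (θ.L : ℝ))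
    (hup : ∀ P, w.up P = upOfRecord₅CS F N ((θ.pinX3H F N lam8 lam12 lam13).view₁₃CoPB10YZW F N Mstar ops ζ lamW) P)
    (h05 : B8LeafOfRecordSubBH θ.toStage3Params lam8)
    (h06 : B9LeafX (Y9OfRecord N θ.toStage3Params Mstar ops))
    (h07 : B11Leaf (Z11OfRecord F N ζ))
    (h08 : PrintedUV3V N θ.L)
    (h09 : ∀ P : B12.RunParams, B12Sec2to5.Lemma4Printed (F12OfRecord₁₂ F N θ.toStage12Params lam12 P) (lam12 P).consts)
    (h09T : ∀ P : B12.RunParams, (leavesP w P).smallCouplings → (leavesP w P).smallFieldInductive)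
    (h10 : ∀ P : B12.RunParams, B13LeafOfRecord θ.toStage3Params (lam13 P))
    (h11 : ∀ P : B12.RunParams, (leavesP w P).b7 → (leavesP w P).b8 → (leavesP w P).b9 → (leavesP w P).b10 → (leavesP w P).b11 →
      (leavesP w P).smallCouplings → (leavesP w P).smallFieldInductive → (leavesP w P).flowControl →
        ∀ k, k < P.K → SLaw₁₃CoP F N θ P k → TLaw₁₃CoP F N θ P k)
    (h12 : ∀ P : B12.RunParams, B15Leaf (WOfRecord₁₃ F N θ lamW P))
    (hR : ∀ (P : B12.RunParams) (k : ℕ), k < P.K → TLaw₁₃CoP F N θ P k → SLaw₁₃CoP F N θ P (k + 1))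
    (hUV : ∀ P : B12.RunParams, (genFlow (betaOfRecord₁₃ F N θ) P.g0).InInterval w.γ P.K → ∀ k, k ≤ P.K → SLaw₁₃CoP F N θ P k →
      ∀ U : GaugeField (F.P P.K) k (SU N),
        chiβOfRecord₁₃ F N θ P.K (gOfRecord₁₃ F N θ P) k U *
              Real.exp (-(1 / (gOfRecord₁₃ F N θ P k) ^ 2 * wilsonBGOfRecord F N θ.εbg P k U)
                - w.em (gOfRecord₁₃ F N θ P k) * (Fintype.card (Site (F.P P.K) k) : ℝ)) ≤ densOfRecord₁₃ F N θ P k U ∧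
        densOfRecord₁₃ F N θ P k U ≤ Real.exp (w.ep (gOfRecord₁₃ F N θ P k) * (Fintype.card (Site (F.P P.K) k) : ℝ))) :
    ∀ P : B12.RunParams, Nodes (leavesP w P) :=
  N24_nodes₁₃CoP_rebindXS_fourPin_pointed θ hP hθ (XPinned₁₃H F N θ lam8 lam12 lam13) Mstar ops ζ lamW w hC hγ hL hup
    (fun P => (N24_upS_pinX3H_view_b8_iff θ lam8 lam12 lam13 Mstar ops ζ lamW P).2 h05) h06 h07 h08
    (fun P => (socket09_pinX3H_iff F N θ lam8 lam12 lam13 P).2 (h09 P)) h09T (fun P _ _ _ _ => (socket10_pinX3H_iff F N θ lam8 lam12 lam13 P).2 (h10 P)) h11 h12 hR hUV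

/-- **N24 · (B2) AT `(datumOfRecord₁₃CoP θ hP).C` FROM THE POINTED CHILDREN ON N05's SURVIVING ROUTE AND THE β-BOX PAIR** (Core-keyed): node00-def-T's S-bound headline
`endStatementBPrinted_of_nodesP_interval_guarded` AT THE S-BOUND WORLD (no record predicate reads the binding) — nodes by §1, the guarded (0.20) and the β-window from the
C-bound twin record (`rgFlow_of_smallCouplings_of_isRecordOfRecord₁₃CCoP`, `N24_betaBoundsInInterval_of_isRecordOfRecord₁₃CCoP_of_boxH`; both read `w.C`, `w.γ` only).
[cite: Balaban1989LargeFieldII, Thm 1 p.355 + p.391; Balaban1987RG1, (0.20) p.256, (1.22) p.264; Balaban1985RegularSpaces, Thm 8 (1.146) p.101 (bookkeeping + elementary window)] -/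
theorem N24_endStatementBPrinted₁₃CoP_pinX3HS_fourPin_pointed (θ : Stage13Params F N) (hP : θ.Provisos₁₃Core F N) (hθ : θ.Admissible F N)
    (lam8 : ResidB8 θ.toStage3Params) (lam12 : ResidB12 F N θ.τ9.M) (lam13 : B12.RunParams → ResidB13 θ.toStage3Params)
    (Mstar : ℕ) (ops : OpsY N θ.toStage3Params Mstar) (ζ : ResidZ F N) (lamW : ResidW F N) (w : WorldP)
    (hC : w.C = (datumOfRecord₁₃CoP F N θ hP).C) (hγ : 0 < w.γ ∧ w.γ ≤ θ.γ) (hL : w.L = (θ.L : ℝ))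
    (hup : ∀ P, w.up P = upOfRecord₅CS F N ((θ.pinX3H F N lam8 lam12 lam13).view₁₃CoPB10YZW F N Mstar ops ζ lamW) P)
    (h05 : B8LeafOfRecordSubBH θ.toStage3Params lam8)
    (h06 : B9LeafX (Y9OfRecord N θ.toStage3Params Mstar ops))
    (h07 : B11Leaf (Z11OfRecord F N ζ))
    (h08 : PrintedUV3V N θ.L)
    (h09 : ∀ P : B12.RunParams, B12Sec2to5.Lemma4Printed (F12OfRecord₁₂ F N θ.toStage12Params lam12 P) (lam12 P).consts)
    (h09T : ∀ P : B12.RunParams, (leavesP w P).smallCouplings → (leavesP w P).smallFieldInductive)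
    (h10 : ∀ P : B12.RunParams, B13LeafOfRecord θ.toStage3Params (lam13 P))
    (h11 : ∀ P : B12.RunParams, (leavesP w P).b7 → (leavesP w P).b8 → (leavesP w P).b9 → (leavesP w P).b10 → (leavesP w P).b11 →
      (leavesP w P).smallCouplings → (leavesP w P).smallFieldInductive → (leavesP w P).flowControl →
        ∀ k, k < P.K → SLaw₁₃CoP F N θ P k → TLaw₁₃CoP F N θ P k)
    (h12 : ∀ P : B12.RunParams, B15Leaf (WOfRecord₁₃ F N θ lamW P))
    (hR : ∀ (P : B12.RunParams) (k : ℕ), k < P.K → TLaw₁₃CoP F N θ P k → SLaw₁₃CoP F N θ P (k + 1))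
    (hUV : ∀ P : B12.RunParams, (genFlow (betaOfRecord₁₃ F N θ) P.g0).InInterval w.γ P.K → ∀ k, k ≤ P.K → SLaw₁₃CoP F N θ P k →
      ∀ U : GaugeField (F.P P.K) k (SU N),
        chiβOfRecord₁₃ F N θ P.K (gOfRecord₁₃ F N θ P) k U *
              Real.exp (-(1 / (gOfRecord₁₃ F N θ P k) ^ 2 * wilsonBGOfRecord F N θ.εbg P k U)
                - w.em (gOfRecord₁₃ F N θ P k) * (Fintype.card (Site (F.P P.K) k) : ℝ)) ≤ densOfRecord₁₃ F N θ P k U ∧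
        densOfRecord₁₃ F N θ P k U ≤ Real.exp (w.ep (gOfRecord₁₃ F N θ P k) * (Fintype.card (Site (F.P P.K) k) : ℝ))) 
    (hlo : BetaLowerH w.b w.γ (datumOfRecord₁₃CoP F N θ hP).βfun) (hhi : BetaUpperH w.βup w.γ (datumOfRecord₁₃CoP F N θ hP).βfun) :
    B16.EndStatementBPrinted (datumOfRecord₁₃CoP F N θ hP).C :=
  N24_endStatementBPrinted₁₃CoP_rebindXS_fourPin_pointed θ hP hθ (XPinned₁₃H F N θ lam8 lam12 lam13) Mstar ops ζ lamW w hC hγ hL hup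
    (fun P => (N24_upS_pinX3H_view_b8_iff θ lam8 lam12 lam13 Mstar ops ζ lamW P).2 h05) h06 h07 h08
    (fun P => (socket09_pinX3H_iff F N θ lam8 lam12 lam13 P).2 (h09 P)) h09T (fun P _ _ _ _ => (socket10_pinX3H_iff F N θ lam8 lam12 lam13 P).2 (h10 P)) h11 h12 hR hUV hlo hhi

/-- **★ ITEM K1⁵ (stmt-QuantumFields-20294)'s θ-KEYED CONSEQUENT, WITNESSED BY `(θ, hP)`, FROM THE POINTED CHILDREN ON N05's SURVIVING ROUTE** — the world S-bound to the four-pin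
view of the H-pinned parameter, N05 ← the repaired surviving slot, guard `hU` displayed; (B) by the previous theorem at `hP.toCore` (datum bridge `rfl`), window by module 26.
COMPOSITE: nothing is discharged. [cite: Balaban1989LargeFieldII, Thm 1 p.355, (0.1) pp.355–356, p.391; Balaban1985RegularSpaces, Thm 8 (1.146) p.101; Balaban1987RG1, Thm 3 p.264, (0.17)–(0.20) pp.255–256 and (1.22) p.264; Balaban1985UV3, Thm 1 p.257 (bookkeeping + elementary window)] -/
theorem N24_stabilityBR13SepCoP_thetaShape20_pinX3HS_fourPin_pointed (θ : Stage13Params F N) (hP : θ.Provisos₁₃SepCoP F N) (hθ : θ.Admissible F N)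
    (hU : θ.ZtUnity F N ∧ θ.SlotsNondegenerate₁₃ F N)
    (lam8 : ResidB8 θ.toStage3Params) (lam12 : ResidB12 F N θ.τ9.M) (lam13 : B12.RunParams → ResidB13 θ.toStage3Params)
    (Mstar : ℕ) (ops : OpsY N θ.toStage3Params Mstar) (ζ : ResidZ F N) (lamW : ResidW F N) (w : WorldP)
    (hC : w.C = (datumOfRecord₁₃SepCoP F N θ hP).C) (hγ : 0 < w.γ ∧ w.γ ≤ θ.γ) (hL : w.L = (θ.L : ℝ))
    (hup : ∀ P, w.up P = upOfRecord₅CS F N ((θ.pinX3H F N lam8 lam12 lam13).view₁₃CoPB10YZW F N Mstar ops ζ lamW) P)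
    (h05 : B8LeafOfRecordSubBH θ.toStage3Params lam8)
    (h06 : B9LeafX (Y9OfRecord N θ.toStage3Params Mstar ops))
    (h07 : B11Leaf (Z11OfRecord F N ζ))
    (h08 : PrintedUV3V N θ.L)
    (h09 : ∀ P : B12.RunParams, B12Sec2to5.Lemma4Printed (F12OfRecord₁₂ F N θ.toStage12Params lam12 P) (lam12 P).consts)
    (h09T : ∀ P : B12.RunParams, (leavesP w P).smallCouplings → (leavesP w P).smallFieldInductive)
    (h10 : ∀ P : B12.RunParams, B13LeafOfRecord θ.toStage3Params (lam13 P))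
    (h11 : ∀ P : B12.RunParams, (leavesP w P).b7 → (leavesP w P).b8 → (leavesP w P).b9 → (leavesP w P).b10 → (leavesP w P).b11 →
      (leavesP w P).smallCouplings → (leavesP w P).smallFieldInductive → (leavesP w P).flowControl →
        ∀ k, k < P.K → SLaw₁₃CoP F N θ P k → TLaw₁₃CoP F N θ P k)
    (h12 : ∀ P : B12.RunParams, B15Leaf (WOfRecord₁₃ F N θ lamW P))
    (hR : ∀ (P : B12.RunParams) (k : ℕ), k < P.K → TLaw₁₃CoP F N θ P k → SLaw₁₃CoP F N θ P (k + 1))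
    (hUV : ∀ P : B12.RunParams, (genFlow (betaOfRecord₁₃ F N θ) P.g0).InInterval w.γ P.K → ∀ k, k ≤ P.K → SLaw₁₃CoP F N θ P k →
      ∀ U : GaugeField (F.P P.K) k (SU N),
        chiβOfRecord₁₃ F N θ P.K (gOfRecord₁₃ F N θ P) k U *
              Real.exp (-(1 / (gOfRecord₁₃ F N θ P k) ^ 2 * wilsonBGOfRecord F N θ.εbg P k U)
                - w.em (gOfRecord₁₃ F N θ P k) * (Fintype.card (Site (F.P P.K) k) : ℝ)) ≤ densOfRecord₁₃ F N θ P k U ∧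
        densOfRecord₁₃ F N θ P k U ≤ Real.exp (w.ep (gOfRecord₁₃ F N θ P k) * (Fintype.card (Site (F.P P.K) k) : ℝ))) 
    (hlo : BetaLowerH w.b w.γ (datumOfRecord₁₃SepCoP F N θ hP).βfun) (hhi : BetaUpperH w.βup w.γ (datumOfRecord₁₃SepCoP F N θ hP).βfun) :
    ∃ (θ' : Stage13Params F N) (h' : θ'.Provisos₁₃SepCoP F N), (θ'.ZtUnity F N ∧ θ'.SlotsNondegenerate₁₃ F N) ∧ θ'.Admissible F N ∧
      B16.EndStatementBPrinted (datumOfRecord₁₃SepCoP F N θ' h').C ∧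
      ∃ γ₁ : ℝ, 0 < γ₁ ∧ ∀ γ : ℝ, 0 < γ → γ ≤ γ₁ → ∃ P : B12.RunParams, 1 ≤ P.K ∧ ((datumOfRecord₁₃SepCoP F N θ' h').C P).flow.InInterval γ P.K :=
  N24_stabilityBR13SepCoP_thetaShape20_rebindXS_fourPin_pointed θ hP hθ hU (XPinned₁₃H F N θ lam8 lam12 lam13) Mstar ops ζ lamW w hC hγ hL hup
    (fun P => (N24_upS_pinX3H_view_b8_iff θ lam8 lam12 lam13 Mstar ops ζ lamW P).2 h05) h06 h07 h08
    (fun P => (socket09_pinX3H_iff F N θ lam8 lam12 lam13 P).2 (h09 P)) h09T (fun P _ _ _ _ => (socket10_pinX3H_iff F N θ lam8 lam12 lam13 P).2 (h10 P)) h11 h12 hR hUV hlo hhi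

/-- **★ THE SAME WITNESSED BY node00-def-K0a's LIVE RE-PIN `(θ.liveRepin₁₃, hP)`** — N13's (R₁₃) (dag-n11-e's `laws₁₃CoP_of_liveSel_of_rstep` fed by `hP.rstep` at `liveRepin₁₃_ppSel`),
`Admissible` (`Admissible.liveRepin₁₃`), `SlotsNondegenerate₁₃` (K0a's `slotsNondegenerate₁₃_liveRepin_of_int` from `hP.tstep ∕ hP.rstep`) DISCHARGED BY NAME; `hZ` displayed.
WHICH CHILD BLOCKS FOR K1⁵ ON THE LIVE LINE AND N05's SURVIVING ROUTE = this hypothesis list. [cite: Balaban1989LargeFieldII, Thm 1 p.355, (0.1) pp.355–356, p.391; Balaban1988Convergent, p.244, Thm 2 p.263, (3.16)–(3.22) pp.268–269; Balaban1989LargeFieldI, (0.3)–(0.4) p.176; Balaban1985RegularSpaces, Thm 8 (1.146) p.101; Balaban1987RG1, Thm 3 p.264, (0.17)–(0.21) pp.255–256 and (1.22) p.264 (bookkeeping + elementary window)] -/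
theorem N24_stabilityBR13SepCoP_thetaShape20_pinX3HS_fourPin_pointed_liveRepin₁₃ (θ : Stage13Params F N) (hP : (θ.liveRepin₁₃ F N).Provisos₁₃SepCoP F N)
    (hθ : θ.Admissible F N) (hZ : θ.ZtUnity F N) (hκ : 0 ≤ θ.s2.lf.κ) (hE₀ : 0 ≤ θ.s2.lf.E₀) (hB₀ : 0 ≤ θ.s2.lf.B₀)
    (lam8 : ResidB8 (θ.liveRepin₁₃ F N).toStage3Params) (lam12 : ResidB12 F N (θ.liveRepin₁₃ F N).τ9.M) (lam13 : B12.RunParams → ResidB13 (θ.liveRepin₁₃ F N).toStage3Params)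
    (Mstar : ℕ) (ops : OpsY N (θ.liveRepin₁₃ F N).toStage3Params Mstar) (ζ : ResidZ F N) (lamW : ResidW F N) (w : WorldP)
    (hC : w.C = (datumOfRecord₁₃SepCoP F N (θ.liveRepin₁₃ F N) hP).C) (hγ : 0 < w.γ ∧ w.γ ≤ (θ.liveRepin₁₃ F N).γ) (hL : w.L = ((θ.liveRepin₁₃ F N).L : ℝ))
    (hup : ∀ P, w.up P = upOfRecord₅CS F N (((θ.liveRepin₁₃ F N).pinX3H F N lam8 lam12 lam13).view₁₃CoPB10YZW F N Mstar ops ζ lamW) P)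
    (h05 : B8LeafOfRecordSubBH (θ.liveRepin₁₃ F N).toStage3Params lam8)
    (h06 : B9LeafX (Y9OfRecord N (θ.liveRepin₁₃ F N).toStage3Params Mstar ops))
    (h07 : B11Leaf (Z11OfRecord F N ζ))
    (h08 : PrintedUV3V N (θ.liveRepin₁₃ F N).L)
    (h09 : ∀ P : B12.RunParams, B12Sec2to5.Lemma4Printed (F12OfRecord₁₂ F N (θ.liveRepin₁₃ F N).toStage12Params lam12 P) (lam12 P).consts)
    (h09T : ∀ P : B12.RunParams, (leavesP w P).smallCouplings → (leavesP w P).smallFieldInductive)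
    (h10 : ∀ P : B12.RunParams, B13LeafOfRecord (θ.liveRepin₁₃ F N).toStage3Params (lam13 P))
    (h11 : ∀ P : B12.RunParams, (leavesP w P).b7 → (leavesP w P).b8 → (leavesP w P).b9 → (leavesP w P).b10 → (leavesP w P).b11 →
      (leavesP w P).smallCouplings → (leavesP w P).smallFieldInductive → (leavesP w P).flowControl →
        ∀ k, k < P.K → SLaw₁₃CoP F N (θ.liveRepin₁₃ F N) P k → TLaw₁₃CoP F N (θ.liveRepin₁₃ F N) P k)
    (h12 : ∀ P : B12.RunParams, B15Leaf (WOfRecord₁₃ F N (θ.liveRepin₁₃ F N) lamW P))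
    (hUV : ∀ P : B12.RunParams, (genFlow (betaOfRecord₁₃ F N (θ.liveRepin₁₃ F N)) P.g0).InInterval w.γ P.K → ∀ k, k ≤ P.K → SLaw₁₃CoP F N (θ.liveRepin₁₃ F N) P k →
      ∀ U : GaugeField (F.P P.K) k (SU N),
        chiβOfRecord₁₃ F N (θ.liveRepin₁₃ F N) P.K (gOfRecord₁₃ F N (θ.liveRepin₁₃ F N) P) k U *
              Real.exp (-(1 / (gOfRecord₁₃ F N (θ.liveRepin₁₃ F N) P k) ^ 2 * wilsonBGOfRecord F N (θ.liveRepin₁₃ F N).εbg P k U)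
                - w.em (gOfRecord₁₃ F N (θ.liveRepin₁₃ F N) P k) * (Fintype.card (Site (F.P P.K) k) : ℝ)) ≤ densOfRecord₁₃ F N (θ.liveRepin₁₃ F N) P k U ∧
        densOfRecord₁₃ F N (θ.liveRepin₁₃ F N) P k U ≤ Real.exp (w.ep (gOfRecord₁₃ F N (θ.liveRepin₁₃ F N) P k) * (Fintype.card (Site (F.P P.K) k) : ℝ))) 
    (hlo : BetaLowerH w.b w.γ (datumOfRecord₁₃SepCoP F N (θ.liveRepin₁₃ F N) hP).βfun)
    (hhi : BetaUpperH w.βup w.γ (datumOfRecord₁₃SepCoP F N (θ.liveRepin₁₃ F N) hP).βfun) :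
    ∃ (θ' : Stage13Params F N) (h' : θ'.Provisos₁₃SepCoP F N), (θ'.ZtUnity F N ∧ θ'.SlotsNondegenerate₁₃ F N) ∧ θ'.Admissible F N ∧
      B16.EndStatementBPrinted (datumOfRecord₁₃SepCoP F N θ' h').C ∧
      ∃ γ₁ : ℝ, 0 < γ₁ ∧ ∀ γ : ℝ, 0 < γ → γ ≤ γ₁ → ∃ P : B12.RunParams, 1 ≤ P.K ∧ ((datumOfRecord₁₃SepCoP F N θ' h').C P).flow.InInterval γ P.K :=
  N24_stabilityBR13SepCoP_thetaShape20_pinX3HS_fourPin_pointed (θ.liveRepin₁₃ F N) hP (Stage13Params.Admissible.liveRepin₁₃ hθ)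
    ⟨Stage13Params.ZtUnity.liveRepin₁₃ hZ, (Stage13Params.slotsNondegenerate₁₃_liveRepin_of_int F N θ (fun p j hj => hP.tstep p j hj) (fun p j _ hj => hP.rstep p j hj))⟩
    lam8 lam12 lam13 Mstar ops ζ lamW w hC hγ hL hup h05 h06 h07 h08 h09 h09T h10 h11 h12
    (fun P k hk => laws₁₃CoP_of_liveSel_of_rstep F N (θ.liveRepin₁₃ F N) P (fun p k _ hk => hP.rstep p k hk) (Stage13Params.Admissible.liveRepin₁₃ hθ) hκ hE₀ hB₀
      (Stage13Params.liveRepin₁₃_ppSel F N θ) k hk) hUV hlo hhi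


/-! ## §4. The REGISTERED RUNG BODIES of plan g69's K1⁵ skeleton v3.1 (`K1Skeleton13SepCoPv31`, evidence on stmt-QuantumFields-20294: rung 1 `NodesAtSomeRecord13PWS`, rung 2
`BetaWindowAtSomeRecord13S`, world class `RecordS` = def-T's `IsRecordOfRecord₁₃CSepCoP` at the presenting pair with `upOfRecord₅C ↦ upOfRecord₅CS`) at general `N`, over the S-bound
four-pin view of dag-n05-d's H-pin — `RecordS` is skeleton-LOCAL, so its ∃-body is stated LITERALLY -/

/-- **A world S-bound to the four-pin view of a re-bound parameter `θ.rebindX X'` IS in the skeleton's S-class `RecordS F θ hP w`** (∃-body literal; `X'` FREE — at dag-n05-d's H-pin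
instantiate `X' := XPinned₁₃H θ λ₈ λ₁₂ λ₁₃`, `θ.pinX3H … = θ.rebindX …` by `rfl`): presenting parameter the quadruply pinned `((((θ.rebindX X').pinB10).pinY (Y9OfRecord …)).pinZ (Z11OfRecord ζ)).pinW
(WOfRecord₁₃ (θ.rebindX X') λW)` with dag-n10-d's `Provisos₁₃SepCoP.rebindX ∕ .pin*`, `pin*_admissible_iff`, the datum chain `datumOfRecord₁₃SepCoP_rebindX ∕ _pin*` (`rfl`s) and `view₁₃CoPB10YZW_eq`. [cite: Balaban1989LargeFieldII, Thm 1 + (0.1) pp.355–356; Balaban1985RegularSpaces, Thm 8 (1.146) p.101; Balaban1985UV3, Thm 1 p.257; Balaban1985BackgroundPropagators, Thm 3.1 p.397; Balaban1985Variational, Thm 1 p.279; Balaban1989LargeFieldI, (0.2) p.176 (bookkeeping)] -/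
theorem N24_recordS₁₃SepCoP_of_upS_rebindX_view (θ : Stage13Params F N) (hP : θ.Provisos₁₃SepCoP F N) (hθ : θ.Admissible F N)
    (X' : B12.RunParams → PrintedCarriersR) (Mstar : ℕ) (ops : OpsY N θ.toStage3Params Mstar) (ζ : ResidZ F N) (lamW : ResidW F N) (w : WorldP)
    (hC : w.C = (datumOfRecord₁₃SepCoP F N θ hP).C) (hγ : 0 < w.γ ∧ w.γ ≤ θ.γ) (hL : w.L = (θ.L : ℝ))
    (hup : ∀ P, w.up P = upOfRecord₅CS F N ((θ.rebindX F N X').view₁₃CoPB10YZW F N Mstar ops ζ lamW) P) :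
    ∃ (θ' : Stage13Params F N) (h' : θ'.Provisos₁₃SepCoP F N), θ'.Admissible F N ∧
      datumOfRecord₁₃SepCoP F N θ hP = datumOfRecord₁₃SepCoP F N θ' h' ∧ w.C = (datumOfRecord₁₃SepCoP F N θ hP).C ∧ (0 < w.γ ∧ w.γ ≤ θ'.γ) ∧
      w.L = (θ'.L : ℝ) ∧ ∀ P : B12.RunParams, w.up P = upOfRecord₅CS F N (θ'.toStage5₁₃CoP F N) P := by
  have hX : (θ.rebindX F N X').Provisos₁₃SepCoP F N := hP.rebindX X'
  have hDX : datumOfRecord₁₃SepCoP F N (θ.rebindX F N X') hX = datumOfRecord₁₃SepCoP F N θ hP :=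
    datumOfRecord₁₃SepCoP_rebindX F N θ hP X' hX
  refine ⟨((((θ.rebindX F N X').pinB10 F N).pinY F N (Y9OfRecord N (θ.rebindX F N X').toStage3Params Mstar ops)).pinZ F N (Z11OfRecord F N ζ)).pinW F N
      (WOfRecord₁₃ F N (θ.rebindX F N X') lamW),
    ((hX.pinB10.pinY (Y9OfRecord N (θ.rebindX F N X').toStage3Params Mstar ops)).pinZ (Z11OfRecord F N ζ)).pinW (WOfRecord₁₃ F N (θ.rebindX F N X') lamW),
    (Stage13Params.pinW_admissible_iff F N _ _).2 ((Stage13Params.pinZ_admissible_iff F N _ _).2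
      ((Stage13Params.pinY_admissible_iff F N _ _).2 ((Stage13Params.pinB10_admissible_iff F N _).2
        ((Stage13Params.rebindX_admissible_iff F N θ X').2 hθ)))), ?_, hC, hγ, hL, fun P => ?_⟩
  · exact hDX.symm.trans ((datumOfRecord₁₃SepCoP_pinB10 F N _ hX).symm.trans
      ((datumOfRecord₁₃SepCoP_pinY F N _ hX.pinB10 (Y9OfRecord N (θ.rebindX F N X').toStage3Params Mstar ops)).symm.trans
        ((datumOfRecord₁₃SepCoP_pinZ F N _ (hX.pinB10.pinY (Y9OfRecord N (θ.rebindX F N X').toStage3Params Mstar ops)) (Z11OfRecord F N ζ)).symm.trans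
          (datumOfRecord₁₃SepCoP_pinW F N _ ((hX.pinB10.pinY (Y9OfRecord N (θ.rebindX F N X').toStage3Params Mstar ops)).pinZ (Z11OfRecord F N ζ))
            (WOfRecord₁₃ F N (θ.rebindX F N X') lamW)).symm)))
  · rw [hup P, Stage13Params.view₁₃CoPB10YZW_eq]

/-- **THE BODY OF RUNG 1 `NodesAtSomeRecord13PWS` (plan g69 K1⁵ skeleton v3.1; at `N := 2` its ∃-text with `RecordS` unfolded) OVER THE S-BOUND FOUR-PIN VIEW OF `θ.rebindX X'`**
(`X'` FREE): witnesses `(θ, hP, w)` and `λ := λW`; the S-class by the previous lemma, the thirteen nodes by §1, N08's conjunct `PrintedUV3V N θ.L` = the displayed `h08`, the [IV]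
basic-step reading `(leavesP w P).rBasicStep ↔ B15Leaf (WOfRecord₁₃ θ λW P)` at EVERY run from dag-n10-d's four-pin leaves through `withB8` (the selector bound `hK` on `λW` is displayed
and passed through — the closer picks `λW` with a genuine step).  COMPOSITE: the rung's body GIVEN the children; nothing is discharged. [cite: Balaban1989LargeFieldII, Thm 1 p.355, (0.1) pp.355–356, p.391; Balaban1985RegularSpaces, Thm 8 (1.146) p.101; Balaban1985UV3, Thm 1 p.257 + Thm 2 p.272; Balaban1989LargeFieldI, (0.4)–(0.6) p.176, Prop. 1 p.194; Balaban1987RG1, Thm 3 p.264; Balaban1988Convergent, Thm 1 p.262, Cor. 3 (2.50) p.264 (bookkeeping)] -/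
theorem N24_nodesAtSomeRecordS₁₃SepCoP_of_rebindXS_fourPin_pointed (θ : Stage13Params F N) (hP : θ.Provisos₁₃SepCoP F N) (hθ : θ.Admissible F N)
    (hU : θ.ZtUnity F N ∧ θ.SlotsNondegenerate₁₃ F N)
    (X' : B12.RunParams → PrintedCarriersR) (Mstar : ℕ) (ops : OpsY N θ.toStage3Params Mstar) (ζ : ResidZ F N) (lamW : ResidW F N) (w : WorldP)
    (hC : w.C = (datumOfRecord₁₃SepCoP F N θ hP).C) (hγ : 0 < w.γ ∧ w.γ ≤ θ.γ) (hL : w.L = (θ.L : ℝ))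
    (hup : ∀ P, w.up P = upOfRecord₅CS F N ((θ.rebindX F N X').view₁₃CoPB10YZW F N Mstar ops ζ lamW) P)
    (h05S : ∀ P : B12.RunParams, (upOfRecord₅CS F N ((θ.rebindX F N X').view₁₃CoPB10YZW F N Mstar ops ζ lamW) P).b8)
    (h06 : B9LeafX (Y9OfRecord N θ.toStage3Params Mstar ops))
    (h07 : B11Leaf (Z11OfRecord F N ζ))
    (h08 : PrintedUV3V N θ.L)
    (h09 : ∀ P : B12.RunParams, B12Sec2to5.Lemma4Printed (X' P).F12 (X' P).c12)
    (h09T : ∀ P : B12.RunParams, (leavesP w P).smallCouplings → (leavesP w P).smallFieldInductive)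
    (h10 : ∀ P : B12.RunParams, B9LeafX (Y9OfRecord N θ.toStage3Params Mstar ops) →
      (B10.Thm1PrintedCompact (((θ.rebindX F N X').view₁₃CoPB10YZW F N Mstar ops ζ lamW).res.X P).runs10 ∧
          B10.Thm2Printed (((θ.rebindX F N X').view₁₃CoPB10YZW F N Mstar ops ζ lamW).res.X P).runs10) →
        B11Leaf (Z11OfRecord F N ζ) → B12Sec2to5.Lemma4Printed (X' P).F12 (X' P).c12 →
          B13.Lemma1Printed (X' P).S13 (X' P).c13 ∧ B13.Lemma2Printed (X' P).S13 (X' P).c13 ∧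
            B13.Lemma3Printed (X' P).S13 (X' P).c13)
    (h11 : ∀ P : B12.RunParams, (leavesP w P).b7 → (leavesP w P).b8 → (leavesP w P).b9 → (leavesP w P).b10 → (leavesP w P).b11 →
      (leavesP w P).smallCouplings → (leavesP w P).smallFieldInductive → (leavesP w P).flowControl →
        ∀ k, k < P.K → SLaw₁₃CoP F N θ P k → TLaw₁₃CoP F N θ P k)
    (h12 : ∀ P : B12.RunParams, B15Leaf (WOfRecord₁₃ F N θ lamW P))
    (hR : ∀ (P : B12.RunParams) (k : ℕ), k < P.K → TLaw₁₃CoP F N θ P k → SLaw₁₃CoP F N θ P (k + 1))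
    (hUV : ∀ P : B12.RunParams, (genFlow (betaOfRecord₁₃ F N θ) P.g0).InInterval w.γ P.K → ∀ k, k ≤ P.K → SLaw₁₃CoP F N θ P k →
      ∀ U : GaugeField (F.P P.K) k (SU N),
        chiβOfRecord₁₃ F N θ P.K (gOfRecord₁₃ F N θ P) k U *
              Real.exp (-(1 / (gOfRecord₁₃ F N θ P k) ^ 2 * wilsonBGOfRecord F N θ.εbg P k U)
                - w.em (gOfRecord₁₃ F N θ P k) * (Fintype.card (Site (F.P P.K) k) : ℝ)) ≤ densOfRecord₁₃ F N θ P k U ∧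
        densOfRecord₁₃ F N θ P k U ≤ Real.exp (w.ep (gOfRecord₁₃ F N θ P k) * (Fintype.card (Site (F.P P.K) k) : ℝ)))
    (hK : ∀ P : B12.RunParams, 1 ≤ P.K → lamW.kSel P < P.K) :
    ∃ (θ : Stage13Params F N) (hP : θ.Provisos₁₃SepCoP F N) (w : WorldP), (θ.ZtUnity F N ∧ θ.SlotsNondegenerate₁₃ F N) ∧ θ.Admissible F N ∧
      (∃ (θ' : Stage13Params F N) (h' : θ'.Provisos₁₃SepCoP F N), θ'.Admissible F N ∧
      datumOfRecord₁₃SepCoP F N θ hP = datumOfRecord₁₃SepCoP F N θ' h' ∧ w.C = (datumOfRecord₁₃SepCoP F N θ hP).C ∧ (0 < w.γ ∧ w.γ ≤ θ'.γ) ∧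
      w.L = (θ'.L : ℝ) ∧ ∀ P : B12.RunParams, w.up P = upOfRecord₅CS F N (θ'.toStage5₁₃CoP F N) P) ∧
      (∀ P : B12.RunParams, Nodes (leavesP w P)) ∧ PrintedUV3V N θ.L ∧
      ∃ lam : ResidW F N, (∀ P : B12.RunParams, 1 ≤ P.K → lam.kSel P < P.K) ∧
        ∀ P : B12.RunParams, lam.kSel P < P.K → ((leavesP w P).rBasicStep ↔ B15Leaf (WOfRecord₁₃ F N θ lam P)) := by
  refine ⟨θ, hP, w, hU, hθ, N24_recordS₁₃SepCoP_of_upS_rebindX_view θ hP hθ X' Mstar ops ζ lamW w hC hγ hL hup, N24_nodes₁₃CoP_rebindXS_fourPin_pointed θ hP.toCore hθ X' Mstar ops ζ lamW w hC hγ hL hup h05S h06 h07 h08 h09 h09T h10 h11 h12 hR hUV,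
    h08, lamW, hK, fun P _ => ?_⟩
  show (w.up P).rBasicStep ↔ _
  rw [hup P]
  exact (upOfRecord₅C_view₁₃CoPB10YZW_leaves F N (θ.rebindX F N X') Mstar ops ζ lamW P).1

/-- **THE BODY OF RUNG 2 `BetaWindowAtSomeRecord13S` (plan g69 K1⁵ skeleton v3.1; at `N := 2` its ∃-text with `RecordS` unfolded) OVER THE S-BOUND FOUR-PIN VIEW OF `θ.rebindX X'`
FROM THE POINTED CHILDREN AND THE β-BOX PAIR** — β-bounds in the interval from the C-bound twin record (`N24_betaBoundsInInterval_of_isRecordOfRecord₁₃CCoP_of_boxH`), window by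
module 26's `N24_window_of_betaUpperH`.  WHICH CHILD BLOCKS = the hypothesis list. [cite: Balaban1989LargeFieldII, Thm 1 p.355, (0.1) pp.355–356, p.391; Balaban1987RG1, Thm 3 p.264, (0.17)–(0.20) pp.255–256 and (1.22) p.264, (2.9) p.266; Balaban1985RegularSpaces, Thm 8 (1.146) p.101 (bookkeeping + elementary window)] -/
theorem N24_betaWindowAtSomeRecordS₁₃SepCoP_of_rebindXS_fourPin_pointed_of_boxH (θ : Stage13Params F N) (hP : θ.Provisos₁₃SepCoP F N) (hθ : θ.Admissible F N)
    (hU : θ.ZtUnity F N ∧ θ.SlotsNondegenerate₁₃ F N)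
    (X' : B12.RunParams → PrintedCarriersR) (Mstar : ℕ) (ops : OpsY N θ.toStage3Params Mstar) (ζ : ResidZ F N) (lamW : ResidW F N) (w : WorldP)
    (hC : w.C = (datumOfRecord₁₃SepCoP F N θ hP).C) (hγ : 0 < w.γ ∧ w.γ ≤ θ.γ) (hL : w.L = (θ.L : ℝ))
    (hup : ∀ P, w.up P = upOfRecord₅CS F N ((θ.rebindX F N X').view₁₃CoPB10YZW F N Mstar ops ζ lamW) P)
    (h05S : ∀ P : B12.RunParams, (upOfRecord₅CS F N ((θ.rebindX F N X').view₁₃CoPB10YZW F N Mstar ops ζ lamW) P).b8)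
    (h06 : B9LeafX (Y9OfRecord N θ.toStage3Params Mstar ops))
    (h07 : B11Leaf (Z11OfRecord F N ζ))
    (h08 : PrintedUV3V N θ.L)
    (h09 : ∀ P : B12.RunParams, B12Sec2to5.Lemma4Printed (X' P).F12 (X' P).c12)
    (h09T : ∀ P : B12.RunParams, (leavesP w P).smallCouplings → (leavesP w P).smallFieldInductive)
    (h10 : ∀ P : B12.RunParams, B9LeafX (Y9OfRecord N θ.toStage3Params Mstar ops) →
      (B10.Thm1PrintedCompact (((θ.rebindX F N X').view₁₃CoPB10YZW F N Mstar ops ζ lamW).res.X P).runs10 ∧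
          B10.Thm2Printed (((θ.rebindX F N X').view₁₃CoPB10YZW F N Mstar ops ζ lamW).res.X P).runs10) →
        B11Leaf (Z11OfRecord F N ζ) → B12Sec2to5.Lemma4Printed (X' P).F12 (X' P).c12 →
          B13.Lemma1Printed (X' P).S13 (X' P).c13 ∧ B13.Lemma2Printed (X' P).S13 (X' P).c13 ∧
            B13.Lemma3Printed (X' P).S13 (X' P).c13)
    (h11 : ∀ P : B12.RunParams, (leavesP w P).b7 → (leavesP w P).b8 → (leavesP w P).b9 → (leavesP w P).b10 → (leavesP w P).b11 →
      (leavesP w P).smallCouplings → (leavesP w P).smallFieldInductive → (leavesP w P).flowControl →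
        ∀ k, k < P.K → SLaw₁₃CoP F N θ P k → TLaw₁₃CoP F N θ P k)
    (h12 : ∀ P : B12.RunParams, B15Leaf (WOfRecord₁₃ F N θ lamW P))
    (hR : ∀ (P : B12.RunParams) (k : ℕ), k < P.K → TLaw₁₃CoP F N θ P k → SLaw₁₃CoP F N θ P (k + 1))
    (hUV : ∀ P : B12.RunParams, (genFlow (betaOfRecord₁₃ F N θ) P.g0).InInterval w.γ P.K → ∀ k, k ≤ P.K → SLaw₁₃CoP F N θ P k →
      ∀ U : GaugeField (F.P P.K) k (SU N),
        chiβOfRecord₁₃ F N θ P.K (gOfRecord₁₃ F N θ P) k U *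
              Real.exp (-(1 / (gOfRecord₁₃ F N θ P k) ^ 2 * wilsonBGOfRecord F N θ.εbg P k U)
                - w.em (gOfRecord₁₃ F N θ P k) * (Fintype.card (Site (F.P P.K) k) : ℝ)) ≤ densOfRecord₁₃ F N θ P k U ∧
        densOfRecord₁₃ F N θ P k U ≤ Real.exp (w.ep (gOfRecord₁₃ F N θ P k) * (Fintype.card (Site (F.P P.K) k) : ℝ)))
    (hlo : BetaLowerH w.b w.γ (datumOfRecord₁₃SepCoP F N θ hP).βfun) (hhi : BetaUpperH w.βup w.γ (datumOfRecord₁₃SepCoP F N θ hP).βfun) :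
    ∃ (θ : Stage13Params F N) (hP : θ.Provisos₁₃SepCoP F N) (w : WorldP), (θ.ZtUnity F N ∧ θ.SlotsNondegenerate₁₃ F N) ∧ θ.Admissible F N ∧
      (∃ (θ' : Stage13Params F N) (h' : θ'.Provisos₁₃SepCoP F N), θ'.Admissible F N ∧
      datumOfRecord₁₃SepCoP F N θ hP = datumOfRecord₁₃SepCoP F N θ' h' ∧ w.C = (datumOfRecord₁₃SepCoP F N θ hP).C ∧ (0 < w.γ ∧ w.γ ≤ θ'.γ) ∧
      w.L = (θ'.L : ℝ) ∧ ∀ P : B12.RunParams, w.up P = upOfRecord₅CS F N (θ'.toStage5₁₃CoP F N) P) ∧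
      (∀ P : B12.RunParams, Nodes (leavesP w P)) ∧ BetaBoundsInInterval w.C.toB12 w.γ w.b w.βup ∧
      ∃ γ₁ : ℝ, 0 < γ₁ ∧ ∀ γ : ℝ, 0 < γ → γ ≤ γ₁ → ∃ P : B12.RunParams, 1 ≤ P.K ∧ ((datumOfRecord₁₃SepCoP F N θ hP).C P).flow.InInterval γ P.K :=
  ⟨θ, hP, w, hU, hθ, N24_recordS₁₃SepCoP_of_upS_rebindX_view θ hP hθ X' Mstar ops ζ lamW w hC hγ hL hup, N24_nodes₁₃CoP_rebindXS_fourPin_pointed θ hP.toCore hθ X' Mstar ops ζ lamW w hC hγ hL hup h05S h06 h07 h08 h09 h09T h10 h11 h12 hR hUV,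
    N24_betaBoundsInInterval_of_isRecordOfRecord₁₃CCoP_of_boxH
      (N24_isRecordOfRecord₁₃CCoP_twin_of_upS_rebindX_view θ hP.toCore hθ X' Mstar ops ζ lamW w hC hγ hL) hlo hhi,
    N24_window_of_betaUpperH _ hγ.1 hhi⟩

/-- **RUNG 1's BODY AT dag-n05-d's H-PIN** (`X' := XPinned₁₃H θ λ₈ λ₁₂ λ₁₃`): N05 ← `B8LeafOfRecordSubBH θ₃ λ₈`, N09 ← Lemma 4 at `F12OfRecord₁₂ θ₁₂ λ₁₂`, N10 ← `B13LeafOfRecord θ₃ (λ₁₃ P)`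
(the previous theorem through the three `Iff.rfl` sockets and §0's `b8` reading). [cite: Balaban1989LargeFieldII, Thm 1 p.355, (0.1) pp.355–356, p.391; Balaban1985RegularSpaces, Thm 8 (1.146) p.101; Balaban1985UV3, Thm 1 p.257 + Thm 2 p.272; Balaban1989LargeFieldI, Prop. 1 p.194; Balaban1987RG1, Thm 3 p.264, Lemma 4 p.280; Balaban1988RG2Cluster, Lemmas 1–3 pp.9–20 (bookkeeping)] -/
theorem N24_nodesAtSomeRecordS₁₃SepCoP_of_pinX3HS_fourPin_pointed (θ : Stage13Params F N) (hP : θ.Provisos₁₃SepCoP F N) (hθ : θ.Admissible F N)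
    (hU : θ.ZtUnity F N ∧ θ.SlotsNondegenerate₁₃ F N)
    (lam8 : ResidB8 θ.toStage3Params) (lam12 : ResidB12 F N θ.τ9.M) (lam13 : B12.RunParams → ResidB13 θ.toStage3Params)
    (Mstar : ℕ) (ops : OpsY N θ.toStage3Params Mstar) (ζ : ResidZ F N) (lamW : ResidW F N) (w : WorldP)
    (hC : w.C = (datumOfRecord₁₃SepCoP F N θ hP).C) (hγ : 0 < w.γ ∧ w.γ ≤ θ.γ) (hL : w.L = (θ.L : ℝ))
    (hup : ∀ P, w.up P = upOfRecord₅CS F N ((θ.pinX3H F N lam8 lam12 lam13).view₁₃CoPB10YZW F N Mstar ops ζ lamW) P)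
    (h05 : B8LeafOfRecordSubBH θ.toStage3Params lam8)
    (h06 : B9LeafX (Y9OfRecord N θ.toStage3Params Mstar ops))
    (h07 : B11Leaf (Z11OfRecord F N ζ))
    (h08 : PrintedUV3V N θ.L)
    (h09 : ∀ P : B12.RunParams, B12Sec2to5.Lemma4Printed (F12OfRecord₁₂ F N θ.toStage12Params lam12 P) (lam12 P).consts)
    (h09T : ∀ P : B12.RunParams, (leavesP w P).smallCouplings → (leavesP w P).smallFieldInductive)
    (h10 : ∀ P : B12.RunParams, B13LeafOfRecord θ.toStage3Params (lam13 P))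
    (h11 : ∀ P : B12.RunParams, (leavesP w P).b7 → (leavesP w P).b8 → (leavesP w P).b9 → (leavesP w P).b10 → (leavesP w P).b11 →
      (leavesP w P).smallCouplings → (leavesP w P).smallFieldInductive → (leavesP w P).flowControl →
        ∀ k, k < P.K → SLaw₁₃CoP F N θ P k → TLaw₁₃CoP F N θ P k)
    (h12 : ∀ P : B12.RunParams, B15Leaf (WOfRecord₁₃ F N θ lamW P))
    (hR : ∀ (P : B12.RunParams) (k : ℕ), k < P.K → TLaw₁₃CoP F N θ P k → SLaw₁₃CoP F N θ P (k + 1))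
    (hUV : ∀ P : B12.RunParams, (genFlow (betaOfRecord₁₃ F N θ) P.g0).InInterval w.γ P.K → ∀ k, k ≤ P.K → SLaw₁₃CoP F N θ P k →
      ∀ U : GaugeField (F.P P.K) k (SU N),
        chiβOfRecord₁₃ F N θ P.K (gOfRecord₁₃ F N θ P) k U *
              Real.exp (-(1 / (gOfRecord₁₃ F N θ P k) ^ 2 * wilsonBGOfRecord F N θ.εbg P k U)
                - w.em (gOfRecord₁₃ F N θ P k) * (Fintype.card (Site (F.P P.K) k) : ℝ)) ≤ densOfRecord₁₃ F N θ P k U ∧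
        densOfRecord₁₃ F N θ P k U ≤ Real.exp (w.ep (gOfRecord₁₃ F N θ P k) * (Fintype.card (Site (F.P P.K) k) : ℝ)))
    (hK : ∀ P : B12.RunParams, 1 ≤ P.K → lamW.kSel P < P.K) :
    ∃ (θ : Stage13Params F N) (hP : θ.Provisos₁₃SepCoP F N) (w : WorldP), (θ.ZtUnity F N ∧ θ.SlotsNondegenerate₁₃ F N) ∧ θ.Admissible F N ∧
      (∃ (θ' : Stage13Params F N) (h' : θ'.Provisos₁₃SepCoP F N), θ'.Admissible F N ∧
      datumOfRecord₁₃SepCoP F N θ hP = datumOfRecord₁₃SepCoP F N θ' h' ∧ w.C = (datumOfRecord₁₃SepCoP F N θ hP).C ∧ (0 < w.γ ∧ w.γ ≤ θ'.γ) ∧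
      w.L = (θ'.L : ℝ) ∧ ∀ P : B12.RunParams, w.up P = upOfRecord₅CS F N (θ'.toStage5₁₃CoP F N) P) ∧
      (∀ P : B12.RunParams, Nodes (leavesP w P)) ∧ PrintedUV3V N θ.L ∧
      ∃ lam : ResidW F N, (∀ P : B12.RunParams, 1 ≤ P.K → lam.kSel P < P.K) ∧
        ∀ P : B12.RunParams, lam.kSel P < P.K → ((leavesP w P).rBasicStep ↔ B15Leaf (WOfRecord₁₃ F N θ lam P)) :=
  N24_nodesAtSomeRecordS₁₃SepCoP_of_rebindXS_fourPin_pointed θ hP hθ hU (XPinned₁₃H F N θ lam8 lam12 lam13) Mstar ops ζ lamW w hC hγ hL hup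
    (fun P => (N24_upS_pinX3H_view_b8_iff θ lam8 lam12 lam13 Mstar ops ζ lamW P).2 h05) h06 h07 h08
    (fun P => (socket09_pinX3H_iff F N θ lam8 lam12 lam13 P).2 (h09 P)) h09T (fun P _ _ _ _ => (socket10_pinX3H_iff F N θ lam8 lam12 lam13 P).2 (h10 P)) h11 h12 hR hUV hK

/-- **RUNG 2's BODY AT dag-n05-d's H-PIN** (`X' := XPinned₁₃H θ λ₈ λ₁₂ λ₁₃`), from the pointed children on N05's surviving route and the β-box pair.
[cite: Balaban1989LargeFieldII, Thm 1 p.355, (0.1) pp.355–356, p.391; Balaban1987RG1, Thm 3 p.264, (0.17)–(0.20) pp.255–256 and (1.22) p.264; Balaban1985RegularSpaces, Thm 8 (1.146) p.101 (bookkeeping + elementary window)] -/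
theorem N24_betaWindowAtSomeRecordS₁₃SepCoP_of_pinX3HS_fourPin_pointed_of_boxH (θ : Stage13Params F N) (hP : θ.Provisos₁₃SepCoP F N) (hθ : θ.Admissible F N)
    (hU : θ.ZtUnity F N ∧ θ.SlotsNondegenerate₁₃ F N)
    (lam8 : ResidB8 θ.toStage3Params) (lam12 : ResidB12 F N θ.τ9.M) (lam13 : B12.RunParams → ResidB13 θ.toStage3Params)
    (Mstar : ℕ) (ops : OpsY N θ.toStage3Params Mstar) (ζ : ResidZ F N) (lamW : ResidW F N) (w : WorldP)
    (hC : w.C = (datumOfRecord₁₃SepCoP F N θ hP).C) (hγ : 0 < w.γ ∧ w.γ ≤ θ.γ) (hL : w.L = (θ.L : ℝ))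
    (hup : ∀ P, w.up P = upOfRecord₅CS F N ((θ.pinX3H F N lam8 lam12 lam13).view₁₃CoPB10YZW F N Mstar ops ζ lamW) P)
    (h05 : B8LeafOfRecordSubBH θ.toStage3Params lam8)
    (h06 : B9LeafX (Y9OfRecord N θ.toStage3Params Mstar ops))
    (h07 : B11Leaf (Z11OfRecord F N ζ))
    (h08 : PrintedUV3V N θ.L)
    (h09 : ∀ P : B12.RunParams, B12Sec2to5.Lemma4Printed (F12OfRecord₁₂ F N θ.toStage12Params lam12 P) (lam12 P).consts)
    (h09T : ∀ P : B12.RunParams, (leavesP w P).smallCouplings → (leavesP w P).smallFieldInductive)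
    (h10 : ∀ P : B12.RunParams, B13LeafOfRecord θ.toStage3Params (lam13 P))
    (h11 : ∀ P : B12.RunParams, (leavesP w P).b7 → (leavesP w P).b8 → (leavesP w P).b9 → (leavesP w P).b10 → (leavesP w P).b11 →
      (leavesP w P).smallCouplings → (leavesP w P).smallFieldInductive → (leavesP w P).flowControl →
        ∀ k, k < P.K → SLaw₁₃CoP F N θ P k → TLaw₁₃CoP F N θ P k)
    (h12 : ∀ P : B12.RunParams, B15Leaf (WOfRecord₁₃ F N θ lamW P))
    (hR : ∀ (P : B12.RunParams) (k : ℕ), k < P.K → TLaw₁₃CoP F N θ P k → SLaw₁₃CoP F N θ P (k + 1))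
    (hUV : ∀ P : B12.RunParams, (genFlow (betaOfRecord₁₃ F N θ) P.g0).InInterval w.γ P.K → ∀ k, k ≤ P.K → SLaw₁₃CoP F N θ P k →
      ∀ U : GaugeField (F.P P.K) k (SU N),
        chiβOfRecord₁₃ F N θ P.K (gOfRecord₁₃ F N θ P) k U *
              Real.exp (-(1 / (gOfRecord₁₃ F N θ P k) ^ 2 * wilsonBGOfRecord F N θ.εbg P k U)
                - w.em (gOfRecord₁₃ F N θ P k) * (Fintype.card (Site (F.P P.K) k) : ℝ)) ≤ densOfRecord₁₃ F N θ P k U ∧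
        densOfRecord₁₃ F N θ P k U ≤ Real.exp (w.ep (gOfRecord₁₃ F N θ P k) * (Fintype.card (Site (F.P P.K) k) : ℝ)))
    (hlo : BetaLowerH w.b w.γ (datumOfRecord₁₃SepCoP F N θ hP).βfun) (hhi : BetaUpperH w.βup w.γ (datumOfRecord₁₃SepCoP F N θ hP).βfun) :
    ∃ (θ : Stage13Params F N) (hP : θ.Provisos₁₃SepCoP F N) (w : WorldP), (θ.ZtUnity F N ∧ θ.SlotsNondegenerate₁₃ F N) ∧ θ.Admissible F N ∧
      (∃ (θ' : Stage13Params F N) (h' : θ'.Provisos₁₃SepCoP F N), θ'.Admissible F N ∧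
      datumOfRecord₁₃SepCoP F N θ hP = datumOfRecord₁₃SepCoP F N θ' h' ∧ w.C = (datumOfRecord₁₃SepCoP F N θ hP).C ∧ (0 < w.γ ∧ w.γ ≤ θ'.γ) ∧
      w.L = (θ'.L : ℝ) ∧ ∀ P : B12.RunParams, w.up P = upOfRecord₅CS F N (θ'.toStage5₁₃CoP F N) P) ∧
      (∀ P : B12.RunParams, Nodes (leavesP w P)) ∧ BetaBoundsInInterval w.C.toB12 w.γ w.b w.βup ∧
      ∃ γ₁ : ℝ, 0 < γ₁ ∧ ∀ γ : ℝ, 0 < γ → γ ≤ γ₁ → ∃ P : B12.RunParams, 1 ≤ P.K ∧ ((datumOfRecord₁₃SepCoP F N θ hP).C P).flow.InInterval γ P.K :=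
  N24_betaWindowAtSomeRecordS₁₃SepCoP_of_rebindXS_fourPin_pointed_of_boxH θ hP hθ hU (XPinned₁₃H F N θ lam8 lam12 lam13) Mstar ops ζ lamW w hC hγ hL hup
    (fun P => (N24_upS_pinX3H_view_b8_iff θ lam8 lam12 lam13 Mstar ops ζ lamW P).2 h05) h06 h07 h08
    (fun P => (socket09_pinX3H_iff F N θ lam8 lam12 lam13 P).2 (h09 P)) h09T (fun P _ _ _ _ => (socket10_pinX3H_iff F N θ lam8 lam12 lam13 P).2 (h10 P)) h11 h12 hR hUV hlo hhi

end Literature.MathematicalPhysics.QuantumFieldTheory.Balaban1983to89.Node00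

end
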